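import Mathlib

/-!
# Amalgamation of two `H`-good zero-sum-free sets (solo-blind, door I1⁗ / (K₃), s79)

The construction principle behind the squarefree extremal families: if `S₁`, `S₂` are zero-sum-free
finite subsets of an abelian group, both `H`-good for `τ` (no subset sums to `-τ`), and the subgroups
they generate meet only inside `{0, τ, -τ}`, then `S₁ ∪ S₂` is zero-sum free, and (when `τ` lies in both
generated subgroups) the representations of `τ` by subsets of `S₁ ∪ S₂` are exactly those by subsets of
`S₁` together with those by subsets of `S₂`; for disjoint `S₁`, `S₂` the representation counts add in
every size.  No hypothesis on the group is needed.
-/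

namespace Summit.MatrixMultiplication.MatrixMultiplication.Theorems

open Finset

variable {G : Type*} [AddCommGroup G] [DecidableEq G]

/-- All subsets of `S` whose sum is `τ` (the representations of `τ` by the set `S`). -/
def soloBlindRepAll (S : Finset G) (τ : G) : Finset (Finset G) :=
  S.powerset.filter (fun T => ∑ x ∈ T, x = τ)

/-- Membership in `soloBlindRepAll`. -/
theorem soloBlind_mem_repAll {S T : Finset G} {τ : G} :
    T ∈ soloBlindRepAll S τ ↔ T ⊆ S ∧ ∑ x ∈ T, x = τ := by
  simp [soloBlindRepAll]

omit [DecidableEq G] in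
/-- A subset sum of `S` lies in the subgroup generated by `S`. -/
theorem soloBlind_sum_mem_closure {S T : Finset G} (hT : T ⊆ S) :
    ∑ x ∈ T, x ∈ AddSubgroup.closure (S : Set G) :=
  AddSubgroup.sum_mem _ (fun _ hx => AddSubgroup.subset_closure (Finset.mem_coe.mpr (hT hx)))

/-- AMALGAMATION LEMMA, first half: the union of two `H`-good zero-sum-free sets whose generated
subgroups meet inside `{0, τ, -τ}` is zero-sum free. -/
theorem soloBlind_amalgam_zsf {S₁ S₂ : Finset G} {τ : G}
    (z₁ : ∀ T ⊆ S₁, ∑ x ∈ T, x = 0 → T = ∅) (z₂ : ∀ T ⊆ S₂, ∑ x ∈ T, x = 0 → T = ∅)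
    (g₁ : ∀ T ⊆ S₁, ∑ x ∈ T, x ≠ -τ) (g₂ : ∀ T ⊆ S₂, ∑ x ∈ T, x ≠ -τ)
    (meet : ∀ g ∈ AddSubgroup.closure (S₁ : Set G), g ∈ AddSubgroup.closure (S₂ : Set G) →
      g = 0 ∨ g = τ ∨ g = -τ) :
    ∀ T ⊆ S₁ ∪ S₂, ∑ x ∈ T, x = 0 → T = ∅ := by
  intro T hT h0
  set T₁ := T.filter (fun x => x ∈ S₁) with hT₁def
  set T₂ := T.filter (fun x => ¬ x ∈ S₁) with hT₂def
  have hT₁ : T₁ ⊆ S₁ := fun x hx => (Finset.mem_filter.mp hx).2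
  have hT₂ : T₂ ⊆ S₂ := by
    intro x hx
    have hx' := Finset.mem_filter.mp hx
    rcases Finset.mem_union.mp (hT hx'.1) with h | h
    · exact absurd h hx'.2
    · exact h
  have hsplit : ∑ x ∈ T₁, x + ∑ x ∈ T₂, x = 0 := by
    rw [hT₁def, hT₂def, Finset.sum_filter_add_sum_filter_not]; exact h0
  have hs₁ : ∑ x ∈ T₁, x ∈ AddSubgroup.closure (S₁ : Set G) := soloBlind_sum_mem_closure hT₁
  have hs₂ : ∑ x ∈ T₁, x ∈ AddSubgroup.closure (S₂ : Set G) := by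
    have h2 : ∑ x ∈ T₁, x = -(∑ x ∈ T₂, x) := eq_neg_of_add_eq_zero_left hsplit
    rw [h2]; exact AddSubgroup.neg_mem _ (soloBlind_sum_mem_closure hT₂)
  have hTeq : T = T₁ ∪ T₂ := by rw [hT₁def, hT₂def, Finset.filter_union_filter_not_eq]
  rcases meet _ hs₁ hs₂ with h | h | h
  · have e₁ : T₁ = ∅ := z₁ T₁ hT₁ h
    have e₂ : T₂ = ∅ := z₂ T₂ hT₂ (by rw [h, zero_add] at hsplit; exact hsplit)
    rw [hTeq, e₁, e₂]; rfl
  · exfalso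
    have : ∑ x ∈ T₂, x = -τ := by rw [h] at hsplit; exact eq_neg_of_add_eq_zero_right hsplit
    exact g₂ T₂ hT₂ this
  · exact absurd h (g₁ T₁ hT₁)

/-- AMALGAMATION LEMMA, second half: if moreover `τ` lies in both generated subgroups, every
representation of `τ` by a subset of `S₁ ∪ S₂` lies inside `S₁` or inside `S₂`. -/
theorem soloBlind_amalgam_rep {S₁ S₂ : Finset G} {τ : G}
    (z₁ : ∀ T ⊆ S₁, ∑ x ∈ T, x = 0 → T = ∅) (z₂ : ∀ T ⊆ S₂, ∑ x ∈ T, x = 0 → T = ∅)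
    (g₁ : ∀ T ⊆ S₁, ∑ x ∈ T, x ≠ -τ)
    (meet : ∀ g ∈ AddSubgroup.closure (S₁ : Set G), g ∈ AddSubgroup.closure (S₂ : Set G) →
      g = 0 ∨ g = τ ∨ g = -τ)
    (t₂ : τ ∈ AddSubgroup.closure (S₂ : Set G)) :
    soloBlindRepAll (S₁ ∪ S₂) τ = soloBlindRepAll S₁ τ ∪ soloBlindRepAll S₂ τ := by
  ext T
  simp only [Finset.mem_union, soloBlind_mem_repAll]
  constructor
  · rintro ⟨hT, hτ⟩
    set T₁ := T.filter (fun x => x ∈ S₁) with hT₁def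
    set T₂ := T.filter (fun x => ¬ x ∈ S₁) with hT₂def
    have hT₁ : T₁ ⊆ S₁ := fun x hx => (Finset.mem_filter.mp hx).2
    have hT₂ : T₂ ⊆ S₂ := by
      intro x hx
      have hx' := Finset.mem_filter.mp hx
      rcases Finset.mem_union.mp (hT hx'.1) with h | h
      · exact absurd h hx'.2
      · exact h
    have hsplit : ∑ x ∈ T₁, x + ∑ x ∈ T₂, x = τ := by
      rw [hT₁def, hT₂def, Finset.sum_filter_add_sum_filter_not]; exact hτ
    have hTeq : T = T₁ ∪ T₂ := by rw [hT₁def, hT₂def, Finset.filter_union_filter_not_eq]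
    have hs₁ : ∑ x ∈ T₁, x ∈ AddSubgroup.closure (S₁ : Set G) := soloBlind_sum_mem_closure hT₁
    have hs₂ : ∑ x ∈ T₁, x ∈ AddSubgroup.closure (S₂ : Set G) := by
      have h2 : ∑ x ∈ T₁, x = τ - ∑ x ∈ T₂, x := eq_sub_of_add_eq hsplit
      rw [h2]; exact AddSubgroup.sub_mem _ t₂ (soloBlind_sum_mem_closure hT₂)
    rcases meet _ hs₁ hs₂ with h | h | h
    · -- T₁ = ∅, so T = T₂ ⊆ S₂
      have e₁ : T₁ = ∅ := z₁ T₁ hT₁ h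
      right
      refine ⟨?_, hτ⟩
      rw [hTeq, e₁, Finset.empty_union]; exact hT₂
    · -- Σ T₁ = τ, so Σ T₂ = 0, T₂ = ∅, T = T₁ ⊆ S₁
      have e₂ : T₂ = ∅ := z₂ T₂ hT₂ (by rw [h] at hsplit; exact add_eq_left.mp hsplit)
      left
      refine ⟨?_, hτ⟩
      rw [hTeq, e₂, Finset.union_empty]; exact hT₁
    · exact absurd h (g₁ T₁ hT₁)
  · rintro (⟨hT, hτ⟩ | ⟨hT, hτ⟩)
    · exact ⟨hT.trans Finset.subset_union_left, hτ⟩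
    · exact ⟨hT.trans Finset.subset_union_right, hτ⟩

/-- For disjoint `S₁`, `S₂` and an `H`-good `S₁`, no set represents `τ` inside both. -/
theorem soloBlind_amalgam_disjoint {S₁ S₂ : Finset G} {τ : G} (hd : Disjoint S₁ S₂)
    (g₁ : ∀ T ⊆ S₁, ∑ x ∈ T, x ≠ -τ) :
    Disjoint (soloBlindRepAll S₁ τ) (soloBlindRepAll S₂ τ) := by
  rw [Finset.disjoint_left]
  intro T h₁ h₂
  rw [soloBlind_mem_repAll] at h₁ h₂
  have hT : T = ∅ := Finset.subset_empty.mp (by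
    have := Finset.disjoint_iff_inter_eq_empty.mp hd
    rw [← this]; exact Finset.subset_inter h₁.1 h₂.1)
  have h0 : τ = 0 := by rw [← h₁.2, hT, Finset.sum_empty]
  exact g₁ ∅ (Finset.empty_subset _) (by rw [Finset.sum_empty, h0, neg_zero])

/-- AMALGAMATION LEMMA, counting form: under the hypotheses above the number of representations of
`τ` of each size `k` by subsets of `S₁ ∪ S₂` is the sum of the two separate counts. -/
theorem soloBlind_amalgam_card {S₁ S₂ : Finset G} {τ : G} (hd : Disjoint S₁ S₂)
    (z₁ : ∀ T ⊆ S₁, ∑ x ∈ T, x = 0 → T = ∅) (z₂ : ∀ T ⊆ S₂, ∑ x ∈ T, x = 0 → T = ∅)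
    (g₁ : ∀ T ⊆ S₁, ∑ x ∈ T, x ≠ -τ)
    (meet : ∀ g ∈ AddSubgroup.closure (S₁ : Set G), g ∈ AddSubgroup.closure (S₂ : Set G) →
      g = 0 ∨ g = τ ∨ g = -τ)
    (t₂ : τ ∈ AddSubgroup.closure (S₂ : Set G)) (k : ℕ) :
    ((soloBlindRepAll (S₁ ∪ S₂) τ).filter (fun T => T.card = k)).card =
      ((soloBlindRepAll S₁ τ).filter (fun T => T.card = k)).card +
      ((soloBlindRepAll S₂ τ).filter (fun T => T.card = k)).card := by
  rw [soloBlind_amalgam_rep z₁ z₂ g₁ meet t₂, Finset.filter_union,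
      Finset.card_union_of_disjoint]
  exact Finset.disjoint_filter_filter (soloBlind_amalgam_disjoint hd g₁)

end Summit.MatrixMultiplication.MatrixMultiplication.Theorems
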